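import Literature.AnabelianGeometry.SemiGraphs.TemperedOrigin
import Literature.AnabelianGeometry.SemiGraphs.ArithDecompositionDataProofs
import HarnessLib

/-!
# [SemiAnbd] Theorem 6.5 (i), (ii), (iv) «follow formally from [Mzk8], Theorem 1.3 (i), (ii), (iv)»

Mochizuki, *Semi-graphs of anabelioids*, Publ. RIMS **42** (2006) [SemiAnbd], §6, Theorem 6.5
(Tempered Decomposition Groups), author's manuscript pp. 71–72; its printed proof, p. 72 l. 13–14:
«Assertions (i), (ii), (iv) follow formally from [Mzk8], Theorem 1.3, (i), (ii), (iv), respectively.»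
[cite: MochizukiSemiAnbd2006, Thm 6.5 pp.71-72]  Here [Mzk8] = S. Mochizuki, *Galois sections in
absolute anabelian geometry*, Nagoya Math. J. **179** (2005), Theorem 1.3 p. 6 (kurims manuscript):
the same three statements for the decomposition groups `D_x ⊆ Π_{X_K}` of the closed points of `X̄_K` in
the PROFINITE fundamental group, with `I_x := D_x ∩ Δ_X`, `Δ_X = Ker(Π_{X_K} ↠ G_K)`.
[cite: MochizukiGalSect2005, Thm 1.3 p.6]

PROOF-ONLY companion of `TemperedOrigin.lean` / `TemperedAnabelian.lean` (abc-iut cell, block F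
fact-proving wave, seat abc-iut-f-174, FACT-LIST row F-1708 `TemperedOrigin.TemperedDecompositionGroupsHolds`;
theorems only — no `def`, no `instance`, no new named fact; the frozen interface files are imported,
never edited).  The universal closure `∀ Ω, Ω.TemperedDecompositionGroupsHolds` is REFUTED in the tree
(`TemperedOrigin.not_forall_temperedDecompositionGroupsHolds`, abc-iut-f-056): the typed statement has
content only at certified data.  This file supplies the row's positive INSTANCE-FORM PRODUCER by typing the
printed proof sentence as a kernel theorem: for a datum `X : TemperedCurve p` with injection
`ι = X.toHat : Π^temp_{X_K} ↪ Π_{X_K} = X.PiHat` (interface axiom `toHat_injective`, p. 69 «natural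
injection») write

* `D̂_x := ι(D_x) = (X.decomp x).map ι` — for the tempered fundamental group of a hyperbolic curve these ARE
  the (closed) decomposition groups of [Mzk8] §1 p. 6 in `Π_{X_K}` (`D_x ⊆ Π^temp` is compact, being the
  image of a profinite decomposition group, so `ι(D_x)` is closed; cf. `map_toHat_eq_topologicalClosure_of_isCompact`);
* `Î_x := D̂_x ⊓ Ker(X.augHat)` — [Mzk8]'s `I_x := D_x ∩ Δ_X`, `Δ_X = Ker(Π_{X_K} → G_K)`; it equals `ι(I_x)`
  (`map_toHat_inertia`, from `augHat ∘ ι = aug`).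

Then each clause of Theorem 6.5 (i), (ii), (iv) for `Π^temp_{X_K}` (the typed predicates
`DecompDeterminesPoint`, `InertiaDeterminesCusp`, `DecompCommensurablyTerminal`,
`DecompEqCommensuratorOfOpenInertia`, `NoncuspidalNotLeCuspidal` of `TemperedAnabelian.lean`) follows from
the SAME clause of [Mzk8] Thm. 1.3 stated for the family `x ↦ D̂_x`, `Î_x` in `Π_{X_K}` — by transport of
conjugates, inclusions and commensurators along the injective homomorphism `ι`
(`Subgroup.relIndex_map_map_of_injective`; the cell's `map_conjAct_smul`,
`map_mem_commensurator_map_iff`), plus, for the second sentence of (ii), the compactness of the cuspidal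
inertia `I_x ≅ Ẑ(1)` (interface axiom `inertia_equiv_zHat`, p. 71) which makes an open subgroup
`H ⊆ I_x` of finite index with closed image in the Hausdorff group `Π_{X_K}` — exactly the hypothesis shape
of the tree's typing of [Mzk8] Thm. 1.3 (ii) for cusps (`AbsoluteAnabelian.GalSect.Thm_1_3_ii_cusps`:
«for any open subgroup `H ⊆ I_x`» = closed of finite index in the profinite `I_x`).

Main results: `TemperedCurve.decompDeterminesPoint_of_hat`, `inertiaDeterminesCusp_of_hat`,
`decompCommensurablyTerminal_of_hat`, `decompEqCommensuratorOfOpenInertia_of_hat`,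
`noncuspidalNotLeCuspidal_of_hat` (one per printed clause, each from its [Mzk8] counterpart ALONE),
`temperedDecompositionGroups_of_profinite` (the five together) and the origin-quantified
`TemperedOrigin.temperedDecompositionGroupsHolds_of_profinite` — F-1708 REDUCED to [Mzk8] Thm. 1.3
(i)(ii)(iv) for the profinite completions of the certified curves, i.e. to the input its printed proof
cites.  The [Mzk8] hypotheses are carried as explicit binders on `X.PiHat` (the tree types Thm. 1.3 (ii)
over the L4 interface `AbsoluteAnabelian.FundamentalExtension` as `GalSect.Thm_1_3_ii_points` /
`GalSect.Thm_1_3_ii_cusps`, FACT-LIST rows; (i) and (iv) are not typed there — a bridge instantiating the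
binders below from those rows is separate work and is NOT claimed here).

HONEST FRAMING.  Pure group theory and point-set topology over the §6 interface; nothing of [Mzk8] is
proved here (it is the INPUT), nothing is asserted for curves, and nothing here concerns the disputed parts
of inter-universal Teichmüller theory or takes a side on [IUTchIII] Cor. 3.12; typed ≠ proved.
-/

noncomputable section

namespace Literature.AnabelianGeometry.SemiGraphs

namespace TemperedCurve

open scoped Pointwise
open _root_.Topology
open Subgroup.Commensurable (commensurator)

variable {p : ℕ} [Fact p.Prime] (X : TemperedCurve p)

/-! ### Bookkeeping along the injection `ι : Π^temp_{X_K} ↪ Π_{X_K}` -/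

/-- `ι = Π^temp_{X_K} → Π_{X_K}` is injective as a bare homomorphism (interface axiom «natural
injection», p. 69). [cite: MochizukiSemiAnbd2006, §6 p.69] -/
theorem toHat_toMonoidHom_injective : Function.Injective X.toHat.toMonoidHom :=
  fun _ _ h => X.toHat_injective h

/-- `ι(γ D γ⁻¹) = ι(γ) ι(D) ι(γ)⁻¹`: images of `Π^temp`-conjugates are `Π_{X_K}`-conjugates of images.
[cite: MochizukiSemiAnbd2006, §6 p.71] -/
theorem map_toHat_conjAct_smul (γ : ConjAct X.PiTemp) (H : Subgroup X.PiTemp) :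
    (γ • H).map X.toHat.toMonoidHom =
      ConjAct.toConjAct (X.toHat (ConjAct.ofConjAct γ)) • H.map X.toHat.toMonoidHom := by
  have h := map_conjAct_smul X.toHat.toMonoidHom (ConjAct.ofConjAct γ) H
  rw [ConjAct.toConjAct_ofConjAct] at h
  exact h

/-- `ι(I_x) = ι(D_x) ∩ Ker(Π_{X_K} → G_K)`: the image of the tempered inertia `I_x = D_x ∩ Δ^temp_X` is
[Mzk8]'s profinite inertia `D̂_x ∩ Δ_X` of the image `D̂_x = ι(D_x)` (because `augHat ∘ ι = aug`).
[cite: MochizukiSemiAnbd2006, §6 p.71] -/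
theorem map_toHat_inertia (x : X.Pt) :
    (X.inertia x).map X.toHat.toMonoidHom =
      (X.decomp x).map X.toHat.toMonoidHom ⊓ X.augHat.toMonoidHom.ker := by
  ext y
  constructor
  · rintro ⟨g, hg, rfl⟩
    have hg' : g ∈ X.decomp x ⊓ X.aug.toMonoidHom.ker := hg
    have h1 : g ∈ X.decomp x := (Subgroup.mem_inf.mp hg').1
    have h2 : X.aug g = 1 := (Subgroup.mem_inf.mp hg').2
    refine Subgroup.mem_inf.mpr ⟨⟨g, h1, rfl⟩, ?_⟩
    change X.augHat (X.toHat g) = 1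
    rw [X.augHat_comp, h2]
  · intro hy
    obtain ⟨⟨g, hg, rfl⟩, hy2⟩ := Subgroup.mem_inf.mp hy
    have h2 : X.aug g = 1 := by
      rw [← X.augHat_comp]
      exact hy2
    have hg' : g ∈ X.decomp x ⊓ X.aug.toMonoidHom.ker := Subgroup.mem_inf.mpr ⟨hg, h2⟩
    exact ⟨g, hg', rfl⟩

/-- Transfer of a commensurator identity along `ι`: if `C_{Π_{X_K}}(ι H) = ι K` then `C_{Π^temp}(H) = K`
(commensurability is preserved and reflected by the injective `ι`, and `ι g ∈ ι K ⇔ g ∈ K`).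
[cite: MochizukiSemiAnbd2006, Thm 6.5(ii) p.71] -/
theorem commensurator_eq_of_map_toHat {H K : Subgroup X.PiTemp}
    (h : commensurator (H.map X.toHat.toMonoidHom) = K.map X.toHat.toMonoidHom) :
    commensurator H = K := by
  ext g
  rw [← map_mem_commensurator_map_iff X.toHat_toMonoidHom_injective H g, h]
  exact Subgroup.mem_map_iff_mem X.toHat_toMonoidHom_injective

/-- At a cusp the inertia subgroup `I_x ≅ Ẑ(1)` is a COMPACT group (interface axiom
`inertia_equiv_zHat`, p. 71; the set-level form is `TemperedCurve.isCompact_inertia` elsewhere in the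
tree). [cite: MochizukiSemiAnbd2006, §6 p.71] -/
theorem compactSpace_inertia_of_isCusp {x : X.Pt} (hx : X.IsCusp x) : CompactSpace (X.inertia x) := by
  obtain ⟨e⟩ := X.inertia_equiv_zHat x hx
  have e' : X.inertia x ≃ₜ ZHat := e.toHomeomorph
  exact e'.symm.compactSpace

/-- An open subgroup of the compact group `I_x` (cusp `x`) has finite index in `I_x`.
[cite: MochizukiSemiAnbd2006, Thm 6.5(ii) p.71] -/
theorem finiteIndex_subgroupOf_inertia_of_isOpen {x : X.Pt} (hx : X.IsCusp x) (H : Subgroup X.PiTemp)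
    (hH : IsOpen ((H.subgroupOf (X.inertia x) : Subgroup (X.inertia x)) : Set (X.inertia x))) :
    (H.subgroupOf (X.inertia x)).FiniteIndex := by
  haveI := X.compactSpace_inertia_of_isCusp hx
  haveI : DiscreteTopology (X.inertia x ⧸ H.subgroupOf (X.inertia x)) :=
    QuotientGroup.discreteTopology_iff.mpr hH
  haveI : Finite (X.inertia x ⧸ H.subgroupOf (X.inertia x)) := finite_of_compact_of_discrete
  exact Subgroup.finiteIndex_of_finite_quotient

/-- An open subgroup `H ⊆ I_x` of the compact cuspidal inertia has CLOSED image `ι(H)` in the Hausdorff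
group `Π_{X_K}` (open ⇒ closed in `I_x` ⇒ compact ⇒ compact image).
[cite: MochizukiSemiAnbd2006, Thm 6.5(ii) p.71] -/
theorem isClosed_map_toHat_of_isOpen_subgroupOf_inertia {x : X.Pt} (hx : X.IsCusp x)
    (H : Subgroup X.PiTemp) (hHI : H ≤ X.inertia x)
    (hH : IsOpen ((H.subgroupOf (X.inertia x) : Subgroup (X.inertia x)) : Set (X.inertia x))) :
    IsClosed (H.map X.toHat.toMonoidHom : Set X.PiHat) := by
  haveI := X.compactSpace_inertia_of_isCusp hx
  haveI : T2Space X.PiHat := X.isProfiniteCompletion_toHat.t2Space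
  have hcl : IsClosed ((H.subgroupOf (X.inertia x) : Subgroup (X.inertia x)) : Set (X.inertia x)) :=
    Subgroup.isClosed_of_isOpen _ hH
  have hcpt : IsCompact ((H.subgroupOf (X.inertia x) : Subgroup (X.inertia x)) : Set (X.inertia x)) :=
    hcl.isCompact
  have himg : (X.toHat ∘ ((↑) : X.inertia x → X.PiTemp)) ''
      ((H.subgroupOf (X.inertia x) : Subgroup (X.inertia x)) : Set (X.inertia x)) =
      (H.map X.toHat.toMonoidHom : Set X.PiHat) := by
    ext y
    constructor
    · rintro ⟨g, hg, rfl⟩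
      exact ⟨g.1, Subgroup.mem_subgroupOf.mp hg, rfl⟩
    · rintro ⟨g, hg, rfl⟩
      exact ⟨⟨g, hHI hg⟩, Subgroup.mem_subgroupOf.mpr hg, rfl⟩
  rw [← himg]
  exact (hcpt.image (X.toHat.continuous.comp continuous_subtype_val)).isClosed

/-- If `D_x` is compact (as it is for the tempered fundamental group of a curve, `D_x` being the image of
a profinite decomposition group), then `ι(D_x)` is closed in `Π_{X_K}` and coincides with the closure of
the image — i.e. `D̂_x := ι(D_x)` IS the (closed) profinite decomposition group generated by `D_x`.
[cite: MochizukiSemiAnbd2006, §6 p.71] -/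
theorem map_toHat_eq_topologicalClosure_of_isCompact (D : Subgroup X.PiTemp)
    (hD : IsCompact (D : Set X.PiTemp)) :
    IsClosed (D.map X.toHat.toMonoidHom : Set X.PiHat) ∧
      (D.map X.toHat.toMonoidHom).topologicalClosure = D.map X.toHat.toMonoidHom := by
  haveI : T2Space X.PiHat := X.isProfiniteCompletion_toHat.t2Space
  have hc : IsClosed (D.map X.toHat.toMonoidHom : Set X.PiHat) := by
    rw [Subgroup.coe_map]
    exact (hD.image X.toHat.continuous).isClosed
  exact ⟨hc, le_antisymm (Subgroup.topologicalClosure_minimal _ le_rfl hc)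
    (Subgroup.le_topologicalClosure _)⟩

/-! ### Theorem 6.5 (i) from [Mzk8] Theorem 1.3 (i) -/

/-- **[SemiAnbd] Thm. 6.5 (i), first sentence** («the closed point `x` is completely determined by the
conjugacy class of `D_x ⊆ Π^temp_{X_K}`») — the typed node `X.DecompDeterminesPoint` — from [Mzk8]
Thm. 1.3 (i), first sentence, for the images `D̂_x = ι(D_x) ⊆ Π_{X_K}`: `Π^temp`-conjugate decomposition
groups have `Π_{X_K}`-conjugate images. [cite: MochizukiSemiAnbd2006, Thm 6.5(i) p.71] -/
theorem decompDeterminesPoint_of_hat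
    (h13i : ∀ x x' : X.Pt, (∃ γ : ConjAct X.PiHat,
        (X.decomp x').map X.toHat.toMonoidHom = γ • (X.decomp x).map X.toHat.toMonoidHom) → x' = x) :
    X.DecompDeterminesPoint := by
  intro x x' hconj
  obtain ⟨γ, hγ⟩ := hconj
  refine h13i x x' ⟨ConjAct.toConjAct (X.toHat (ConjAct.ofConjAct γ)), ?_⟩
  rw [hγ, map_toHat_conjAct_smul]

/-- **[SemiAnbd] Thm. 6.5 (i), second sentence** («if `x` is a cusp, then `x` is completely determined by
the conjugacy class of `I_x ⊆ Π^temp_{X_K}`») — the typed node `X.InertiaDeterminesCusp` — from [Mzk8]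
Thm. 1.3 (i), second sentence, for `Î_x = ι(D_x) ∩ Ker(Π_{X_K} → G_K)` (= `ι(I_x)`, `map_toHat_inertia`).
[cite: MochizukiSemiAnbd2006, Thm 6.5(i) p.71] -/
theorem inertiaDeterminesCusp_of_hat
    (h13i' : ∀ x x' : X.Pt, X.IsCusp x → (∃ γ : ConjAct X.PiHat,
        (X.decomp x').map X.toHat.toMonoidHom ⊓ X.augHat.toMonoidHom.ker =
          γ • ((X.decomp x).map X.toHat.toMonoidHom ⊓ X.augHat.toMonoidHom.ker)) → x' = x) :
    X.InertiaDeterminesCusp := by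
  intro x x' hx hconj
  obtain ⟨γ, hγ⟩ := hconj
  refine h13i' x x' hx ⟨ConjAct.toConjAct (X.toHat (ConjAct.ofConjAct γ)), ?_⟩
  rw [← map_toHat_inertia, ← map_toHat_inertia, hγ, map_toHat_conjAct_smul]

/-! ### Theorem 6.5 (ii) from [Mzk8] Theorem 1.3 (ii) -/

/-- **[SemiAnbd] Thm. 6.5 (ii), first sentence** («`D_x` is commensurably terminal in `Π^temp_{X_K}`») —
the typed node `X.DecompCommensurablyTerminal` — from [Mzk8] Thm. 1.3 (ii), first sentence
(`C_{Π_{X_K}}(D̂_x) = D̂_x` for `D̂_x = ι(D_x)`; tree: `GalSect.Thm_1_3_ii_points`): `g` commensurates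
`D_x` iff `ι g` commensurates `ι(D_x)`, and `ι g ∈ ι(D_x) ⇔ g ∈ D_x`.
[cite: MochizukiSemiAnbd2006, Thm 6.5(ii) p.71] -/
theorem decompCommensurablyTerminal_of_hat
    (h13ii : ∀ x : X.Pt, commensurator ((X.decomp x).map X.toHat.toMonoidHom) =
      (X.decomp x).map X.toHat.toMonoidHom) :
    X.DecompCommensurablyTerminal := fun x =>
  X.commensurator_eq_of_map_toHat (h13ii x)

/-- **[SemiAnbd] Thm. 6.5 (ii), second sentence** («if `x` is a cusp, then `D_x = C_{Π^temp_{X_K}}(H)` for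
any open subgroup `H ⊆ I_x`») — the typed node `X.DecompEqCommensuratorOfOpenInertia` — from [Mzk8]
Thm. 1.3 (ii), second sentence, in the shape of the tree's `GalSect.Thm_1_3_ii_cusps`
(`C_{Π_{X_K}}(Ĥ) = D̂_x` for every CLOSED `Ĥ ⊆ Î_x` of FINITE INDEX in `Î_x`): an open `H ⊆ I_x` of the
compact `I_x ≅ Ẑ(1)` has finite index, its image `ι(H) ⊆ ι(I_x) = Î_x` is closed of the same finite
index (`ι` injective), and the commensurator identity transfers back along `ι`.
[cite: MochizukiSemiAnbd2006, Thm 6.5(ii) p.71] -/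
theorem decompEqCommensuratorOfOpenInertia_of_hat
    (h13ii' : ∀ x : X.Pt, X.IsCusp x → ∀ H : Subgroup X.PiHat,
      H ≤ (X.decomp x).map X.toHat.toMonoidHom ⊓ X.augHat.toMonoidHom.ker →
        IsClosed (H : Set X.PiHat) →
          (H.subgroupOf ((X.decomp x).map X.toHat.toMonoidHom ⊓ X.augHat.toMonoidHom.ker)).FiniteIndex →
            commensurator H = (X.decomp x).map X.toHat.toMonoidHom) :
    X.DecompEqCommensuratorOfOpenInertia := by
  intro x hx H hHI hopen
  apply X.commensurator_eq_of_map_toHat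
  apply h13ii' x hx
  · rw [← map_toHat_inertia]
    exact Subgroup.map_mono hHI
  · exact X.isClosed_map_toHat_of_isOpen_subgroupOf_inertia hx H hHI hopen
  · rw [← map_toHat_inertia]
    haveI := X.finiteIndex_subgroupOf_inertia_of_isOpen hx H hopen
    refine ⟨?_⟩
    change (H.map X.toHat.toMonoidHom).relIndex ((X.inertia x).map X.toHat.toMonoidHom) ≠ 0
    rw [Subgroup.relIndex_map_map_of_injective _ _ X.toHat_toMonoidHom_injective]
    exact Subgroup.FiniteIndex.index_ne_zero

/-! ### Theorem 6.5 (iv) from [Mzk8] Theorem 1.3 (iv) -/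

/-- **[SemiAnbd] Thm. 6.5 (iv)** («no noncuspidal decomposition group of `Π^temp_{X_K}` is contained in a
cuspidal decomposition group of `Π^temp_{X_K}`») — the typed node `X.NoncuspidalNotLeCuspidal` — from
[Mzk8] Thm. 1.3 (iv) for the images: an inclusion `γ D_x γ⁻¹ ⊆ γ' D_{x'} γ'⁻¹` in `Π^temp` maps to the
inclusion `ι(γ) D̂_x ι(γ)⁻¹ ⊆ ι(γ') D̂_{x'} ι(γ')⁻¹` in `Π_{X_K}`.
[cite: MochizukiSemiAnbd2006, Thm 6.5(iv) p.72] -/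
theorem noncuspidalNotLeCuspidal_of_hat
    (h13iv : ∀ x x' : X.Pt, ¬ X.IsCusp x → X.IsCusp x' → ∀ γ γ' : ConjAct X.PiHat,
      ¬ (γ • (X.decomp x).map X.toHat.toMonoidHom ≤ γ' • (X.decomp x').map X.toHat.toMonoidHom)) :
    X.NoncuspidalNotLeCuspidal := by
  intro x x' hx hx' γ γ' hle
  apply h13iv x x' hx hx' (ConjAct.toConjAct (X.toHat (ConjAct.ofConjAct γ)))
    (ConjAct.toConjAct (X.toHat (ConjAct.ofConjAct γ')))
  rw [← map_toHat_conjAct_smul, ← map_toHat_conjAct_smul]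
  exact Subgroup.map_mono hle

/-! ### Theorem 6.5 (i), (ii), (iv) together -/

/-- **[SemiAnbd] Thm. 6.5 (i), (ii), (iv) for `Π^temp_{X_K}`** — the five typed clauses
`DecompDeterminesPoint ∧ InertiaDeterminesCusp ∧ DecompCommensurablyTerminal ∧
DecompEqCommensuratorOfOpenInertia ∧ NoncuspidalNotLeCuspidal` (the `X`-instance of the FACT-LIST row
F-1708 `TemperedOrigin.TemperedDecompositionGroupsHolds`) — «formally from [Mzk8], Theorem 1.3, (i), (ii),
(iv)» (printed proof, p. 72): from the same five statements for the decomposition groups `D̂_x = ι(D_x)`,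
`Î_x = D̂_x ∩ Ker(Π_{X_K} → G_K)` in the profinite completion `Π_{X_K}`.
[cite: MochizukiSemiAnbd2006, Thm 6.5 pp.71-72] -/
theorem temperedDecompositionGroups_of_profinite
    (h13i : ∀ x x' : X.Pt, (∃ γ : ConjAct X.PiHat,
        (X.decomp x').map X.toHat.toMonoidHom = γ • (X.decomp x).map X.toHat.toMonoidHom) → x' = x)
    (h13i' : ∀ x x' : X.Pt, X.IsCusp x → (∃ γ : ConjAct X.PiHat,
        (X.decomp x').map X.toHat.toMonoidHom ⊓ X.augHat.toMonoidHom.ker =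
          γ • ((X.decomp x).map X.toHat.toMonoidHom ⊓ X.augHat.toMonoidHom.ker)) → x' = x)
    (h13ii : ∀ x : X.Pt, commensurator ((X.decomp x).map X.toHat.toMonoidHom) =
      (X.decomp x).map X.toHat.toMonoidHom)
    (h13ii' : ∀ x : X.Pt, X.IsCusp x → ∀ H : Subgroup X.PiHat,
      H ≤ (X.decomp x).map X.toHat.toMonoidHom ⊓ X.augHat.toMonoidHom.ker →
        IsClosed (H : Set X.PiHat) →
          (H.subgroupOf ((X.decomp x).map X.toHat.toMonoidHom ⊓ X.augHat.toMonoidHom.ker)).FiniteIndex →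
            commensurator H = (X.decomp x).map X.toHat.toMonoidHom)
    (h13iv : ∀ x x' : X.Pt, ¬ X.IsCusp x → X.IsCusp x' → ∀ γ γ' : ConjAct X.PiHat,
      ¬ (γ • (X.decomp x).map X.toHat.toMonoidHom ≤ γ' • (X.decomp x').map X.toHat.toMonoidHom)) :
    X.DecompDeterminesPoint ∧ X.InertiaDeterminesCusp ∧ X.DecompCommensurablyTerminal ∧
      X.DecompEqCommensuratorOfOpenInertia ∧ X.NoncuspidalNotLeCuspidal :=
  ⟨X.decompDeterminesPoint_of_hat h13i, X.inertiaDeterminesCusp_of_hat h13i',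
    X.decompCommensurablyTerminal_of_hat h13ii, X.decompEqCommensuratorOfOpenInertia_of_hat h13ii',
    X.noncuspidalNotLeCuspidal_of_hat h13iv⟩

end TemperedCurve

namespace TemperedOrigin

open scoped Pointwise
open Subgroup.Commensurable (commensurator)

variable {p : ℕ} [Fact p.Prime]

/-- **[SemiAnbd] Thm. 6.5 (i), (ii), (iv) as printed** (origin-quantified; the FACT-LIST row F-1708
`Ω.TemperedDecompositionGroupsHolds`) REDUCED TO ITS PRINTED INPUT: it holds as soon as, for every
certified curve `X` (`Ω.IsHyperbolicCurveOrigin X`), [Mzk8] Thm. 1.3 (i), (ii), (iv) hold for the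
decomposition groups `D̂_x = ι(D_x)`, `Î_x = D̂_x ∩ Ker(Π_{X_K} → G_K)` of the profinite completion
`Π_{X_K}` («Assertions (i), (ii), (iv) follow formally from [Mzk8], Theorem 1.3, (i), (ii), (iv)», p. 72).
The origin certificate is necessary (the universal closure over all `Ω` is refuted in the tree); nothing of
[Mzk8] is proved here. [cite: MochizukiSemiAnbd2006, Thm 6.5 pp.71-72] -/
theorem temperedDecompositionGroupsHolds_of_profinite (Ω : TemperedOrigin p)
    (h13 : ∀ X : TemperedCurve p, Ω.IsHyperbolicCurveOrigin X →
      (∀ x x' : X.Pt, (∃ γ : ConjAct X.PiHat,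
        (X.decomp x').map X.toHat.toMonoidHom = γ • (X.decomp x).map X.toHat.toMonoidHom) → x' = x) ∧
      (∀ x x' : X.Pt, X.IsCusp x → (∃ γ : ConjAct X.PiHat,
        (X.decomp x').map X.toHat.toMonoidHom ⊓ X.augHat.toMonoidHom.ker =
          γ • ((X.decomp x).map X.toHat.toMonoidHom ⊓ X.augHat.toMonoidHom.ker)) → x' = x) ∧
      (∀ x : X.Pt, commensurator ((X.decomp x).map X.toHat.toMonoidHom) =
        (X.decomp x).map X.toHat.toMonoidHom) ∧
      (∀ x : X.Pt, X.IsCusp x → ∀ H : Subgroup X.PiHat,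
        H ≤ (X.decomp x).map X.toHat.toMonoidHom ⊓ X.augHat.toMonoidHom.ker →
          IsClosed (H : Set X.PiHat) →
            (H.subgroupOf ((X.decomp x).map X.toHat.toMonoidHom ⊓ X.augHat.toMonoidHom.ker)).FiniteIndex →
              commensurator H = (X.decomp x).map X.toHat.toMonoidHom) ∧
      (∀ x x' : X.Pt, ¬ X.IsCusp x → X.IsCusp x' → ∀ γ γ' : ConjAct X.PiHat,
        ¬ (γ • (X.decomp x).map X.toHat.toMonoidHom ≤ γ' • (X.decomp x').map X.toHat.toMonoidHom))) :
    Ω.TemperedDecompositionGroupsHolds := fun X hX => by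
  obtain ⟨h1, h1', h2, h2', h4⟩ := h13 X hX
  exact X.temperedDecompositionGroups_of_profinite h1 h1' h2 h2' h4

end TemperedOrigin

end Literature.AnabelianGeometry.SemiGraphs

end
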